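import Summits.BirchSwinnertonDyer.BirchSwinnertonDyer.Theorems.PrintCFramBottomClassIndexLawFiveLeBernoulliKummerDictionaryStubs
import Literature.NumberTheory.EllipticCurves.ModularityVersionApProofs
import HarnessLib

/-!
# Crux `PrintCFram.BottomClassIndexLawFiveLe` (stmt-BirchSwinnertonDyer-20372), line `eisenstein-resource-bdp-line` (registry v19):
# THE HEEGNER-FIELD SUPPLY SOCKET — registry v19's Stub C (`stub_heegnerField_of_unitClassFactor`) follows from ONE
# statement about generalized Bernoulli numbers of quadratic characters in which NO elliptic curve, NO `L`-value and NO
# Heegner hypothesis relative to a conductor occurs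
# (cell `bsd-print-cfram`, width seat `bsd-line-cfram-p1-w8` g4; THEOREMS ONLY, `--supports` 20372; BSD is not proved by any of this)

HONEST FRAMING. Nothing here is a statement about BSD and no stub is closed: this file types the exact `GL₁/ℚ`
statement a number theorist (or the planner's analytic item «C», LEAD g11 report §6) has to supply, and proves in the
kernel that it implies Stub C VERBATIM. The statement `(P)` — the hypothesis of `stubC_of_splitPrimes_bernoulliUnit` — reads:

> for every prime `p ≥ 5`, every `m` coprime to `p`, every PRIMITIVE QUADRATIC `ℚ_p`-valued Dirichlet character `χ` mod `m`,
> and `k ∈ {(p+1)/4, (3p−1)/4}` with `2 ≤ k ≤ p − 2` and `χ(−1)(−1)^k = −1` (and — optional for a supplier, available to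
> it — a unit CLASS factor `‖B_{p−k,χ}/(p−k)‖_p = 1`), there is an imaginary quadratic field `K` with `d_K` odd, `d_K < −4`,
> in which EVERY prime `q ∣ p·m` SPLITS, and a Kronecker character `ε_K` of `K`, such that the FIELD factor is a unit:
> `‖B_{k,(χ↑ε_K↑)~}/k‖_p = 1` (`(χ↑ε_K↑)~` = the primitive, i.e. quadratic-of-`e·d_K`, character inducing `χ·ε_K`).

WHY `(P) ⟹ C`: by w8 g3's Kummer dictionary (`KummerDictionary.norm_bernoulliOnePrim_inv_le_inv_iff_of_hss`,
`…_bernoulliCharTwo_le_inv_iff_of_heegner`) the two Kriz–Li Bernoulli hypotheses of C's binders ARE the class / field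
factors above on the class data `(m, χ_e, k)` of `KrizLiBinders.exists_krizLiData_of_cmRamified` (which also records
`k ∈ {(p+1)/4, (3p−1)/4}`); and the Heegner hypothesis for `N_W` follows from «every `q ∣ p·m` splits» because the class data
say `W` has good reduction at every prime `ℓ ≠ p`, `ℓ ∤ m`, while `q ∣ N_W ⟺` bad reduction at `q`
(`WeierstrassCurve.dvd_conductorNorm_iff_not_hasGoodReductionAtPrime`, Diamond–Shurman §8.3), so the primes of `N_W` lie
among those of `p·m` (`dvd_mul_of_dvd_conductorNorm_of_classData`).

WHAT `(P)` IS, mathematically: a HORIZONTAL non-vanishing-mod-`p` statement for `L(1−k, χ_e·ε_d) = −B_{k,χ_eε_d}/k` (a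
Cohen–Eisenstein coefficient `H(k, |e·d|)` up to a unit) along the imaginary quadratic `d` with prescribed splitting at the
finitely many primes of `p·m` — INCLUDING `p`. The companion file `…HeegnerFamilySplitting` shows that on the family
`d = disc(t² − 4n)`, `p·m ∣ n`, `gcd(t, 2pm) = 1`, all these local conditions hold automatically. Nearest print (cell
presearch, w3 g7 / bsd-idea-7 g12 / this seat's notes): Wiles 2015 Thm. 0.0.1, Beckwith–Raum–Richter 2024 Thm. 1 (`k = 1`),
Bruinier 1999 / Ono–Skinner 1998 (conditions only at primes `∤ 4Np`), Byeon 2003 (`k = 2`, no local condition), Horie 1990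
(trace formulae, `k = 1`). beyond-print theorem: NO (a reduction). References: [KrizLi2019] Thm. 1.20, §8;
[Washington1997] Thm. 5.11, Cor. 5.13; [DiamondShurman2005] §8.3; registry v19 `Cruxes/BottomClassIndexLawFiveLe/Lines/eisenstein_resource_bdp_line.lean`.
-/

set_option autoImplicit false
-- summit-side namespace `Summit.BirchSwinnertonDyer.BirchSwinnertonDyer.…` (single-conjunct summit, D-0017 layout)
set_option linter.dupNamespace false

noncomputable section

open scoped Classical
open NumberField WeierstrassCurve DirichletCharacter Literature.NumberTheory.LFunctions
  Literature.NumberTheory.EllipticCurves Literature.NumberTheory.EllipticCurves.KrizLi2019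
  Literature.NumberTheory.EllipticCurves.Rank1Residual
open Literature.NumberTheory.Congruences

namespace Summit.BirchSwinnertonDyer.BirchSwinnertonDyer.Theorems.PrintCFram.HeegnerFieldSupply

open Summit.BirchSwinnertonDyer.BirchSwinnertonDyer.Theorems.PrintCFram
open Summit.BirchSwinnertonDyer.BirchSwinnertonDyer.Theorems.PrintCFram.KummerDictionary
open Summit.BirchSwinnertonDyer.Rank1Residual.X12.O11

/-! ## §1 The primes of `N_W` lie among the primes of `p·m` -/

/-- **The bad primes of a class member divide `p·m`.** If `W/ℚ` has good reduction at every prime `ℓ ≠ p` with `ℓ ∤ m`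
(the good-reduction clause of the class data of `KrizLiBinders.exists_krizLiData_of_cmRamified`), then every prime
`q ∣ N_W` divides `p·m` — since `q ∣ N_W` iff `W` has bad reduction at `q`. [cite: DiamondShurman2005, §8.3 (PDF p. 353, `f_p = 0` iff good reduction)] -/
theorem dvd_mul_of_dvd_conductorNorm_of_classData (W : WeierstrassCurve ℚ) [W.IsElliptic] {p m : ℕ}
    (hgoodW : ∀ ℓ : ℕ, (hℓ : ℓ.Prime) → ℓ ≠ p → ¬ ℓ ∣ m → (haveI := Fact.mk hℓ; W.HasGoodReductionAtPrime ℓ))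
    {q : ℕ} (hq : q.Prime) (hqN : q ∣ W.conductorNorm ℤ) : q ∣ p * m := by
  haveI := Fact.mk hq
  have hbad : ¬ W.HasGoodReductionAtPrime q := (W.dvd_conductorNorm_iff_not_hasGoodReductionAtPrime q).mp hqN
  by_cases hqp : q = p
  · exact hqp ▸ dvd_mul_right q m
  · by_contra hqm
    exact hbad (hgoodW q hq hqp fun h ↦ hqm (dvd_mul_of_dvd_right h p))

/-- **Splitting of the primes of `p·m` gives the Heegner hypothesis for `N_W`** on a class member with the class data's
good-reduction clause. [cite: GrossLMS1991, §1 (p. 235, «all prime factors of N are split»)] [cite: DiamondShurman2005, §8.3 (PDF p. 353)] -/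
theorem satisfiesHeegnerHypothesis_of_split_of_classData (W : WeierstrassCurve ℚ) [W.IsElliptic] {p m : ℕ}
    (hgoodW : ∀ ℓ : ℕ, (hℓ : ℓ.Prime) → ℓ ≠ p → ¬ ℓ ∣ m → (haveI := Fact.mk hℓ; W.HasGoodReductionAtPrime ℓ))
    (K : Type) [Field K]
    (hsplit : ∀ q : ℕ, q.Prime → q ∣ p * m → ((Ideal.span {(q : ℤ)}).primesOver (𝓞 K)).ncard = 2) :
    SatisfiesHeegnerHypothesis (W.conductorNorm ℤ) K :=
  fun q hq hqN ↦ hsplit q hq (dvd_mul_of_dvd_conductorNorm_of_classData W hgoodW hq hqN)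

/-! ## §2 Stub C from the `GL₁` supply statement `(P)` -/

/-- **THE HEEGNER-FIELD SUPPLY SOCKET: `(P) ⟹` Stub C VERBATIM.** The conclusion is registry v19's
`stub_heegnerField_of_unitClassFactor` (= `kriz-li-cover` v2.1's Stub C) restated verbatim; the hypothesis `(P)` is the
curve-free statement of the module docstring: for `p ≥ 5`, `m ⊥ p`, `χ` primitive quadratic mod `m`, `k ∈ {(p+1)/4,(3p−1)/4}`,
`2 ≤ k ≤ p−2`, `χ(−1)(−1)^k = −1`, unit class factor ⟹ an imaginary quadratic `K` (`d_K` odd `< −4`) in which every prime of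
`p·m` splits, with a Kronecker character `ε_K` and UNIT field factor `‖B_{k,(χ↑ε_K↑)~}/k‖_p`. Proof: class data
(`KrizLiBinders.exists_krizLiData_of_cmRamified`), the Kummer dictionary on the binders (w8 g3), and §1.
[cite: KrizLi2019, Thm. 1.20 (p. 8) and §8 (pp. 49–52)] [cite: Washington1997, Thm. 5.11 and Cor. 5.13] -/
theorem stubC_of_splitPrimes_bernoulliUnit
    (hP : ∀ (p : ℕ) [Fact p.Prime] (m : ℕ) [NeZero m] (χ : DirichletCharacter ℚ_[p] m) (k : ℕ),
      5 ≤ p → m.Coprime p → χ.IsPrimitive → χ.IsQuadratic → (k = (p + 1) / 4 ∨ k = (3 * p - 1) / 4) →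
      2 ≤ k → k ≤ p - 2 → χ (-1) * (-1) ^ k = -1 →
      ¬ ‖((p - k : ℕ) : ℚ_[p])⁻¹ * generalizedBernoulli (p - k) χ‖ ≤ (p : ℝ)⁻¹ →
      ∃ (K : Type) (_ : Field K) (_ : NumberField K) (εK : DirichletCharacter ℚ_[p] (NumberField.discr K).natAbs),
        IsImaginaryQuadratic K ∧
        (∀ q : ℕ, q.Prime → q ∣ p * m → ((Ideal.span {(q : ℤ)}).primesOver (𝓞 K)).ncard = 2) ∧
        Odd (NumberField.discr K) ∧ NumberField.discr K < -4 ∧ IsKroneckerCharacterOf K εK ∧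
        ¬ ‖(k : ℚ_[p])⁻¹ * @generalizedBernoulli ℚ_[p] _ _
            (changeLevel (dvd_mul_right m (NumberField.discr K).natAbs) χ *
              changeLevel (dvd_mul_left (NumberField.discr K).natAbs m) εK).conductor ⟨conductor_ne_zero _⟩ k
            (changeLevel (dvd_mul_right m (NumberField.discr K).natAbs) χ *
              changeLevel (dvd_mul_left (NumberField.discr K).natAbs m) εK).primitiveCharacter‖ ≤ (p : ℝ)⁻¹) :
    ∀ (W : WeierstrassCurve ℚ) [W.IsElliptic] [W.IsGloballyMinimal] (p : ℕ) [Fact p.Prime], W.HasCM → CMRamified W p → 5 ≤ p →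
      W.analyticRank = 1 → ∀ (f : ℕ) [NeZero f] (ψ : DirichletCharacter ℚ_[p] f) (ω : DirichletCharacter ℚ_[p] p), ψ.Odd →
      IsTeichmullerCharacter ω →
      (∀ ℓ : ℕ, ℓ.Prime → ¬ (ℓ ∣ p * W.conductorNorm ℤ) →
        ‖((W.LFunction ℓ : ℤ) : ℚ_[p]) - (ψ (ℓ : ZMod f) + ψ⁻¹ (ℓ : ZMod f) * ω (ℓ : ZMod p))‖ < 1) →
      ¬ ‖bernoulliOnePrim ψ⁻¹‖ ≤ (p : ℝ)⁻¹ →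
      ∃ (K : Type) (_ : Field K) (_ : NumberField K) (εK : DirichletCharacter ℚ_[p] (NumberField.discr K).natAbs),
        IsImaginaryQuadratic K ∧ SatisfiesHeegnerHypothesis (W.conductorNorm ℤ) K ∧ Odd (NumberField.discr K) ∧
        NumberField.discr K < -4 ∧ IsKroneckerCharacterOf K εK ∧
        ¬ ‖bernoulliOnePrim (bernoulliCharTwo ψ εK ω)‖ ≤ (p : ℝ)⁻¹ := by
  intro W _ _ p _ hCM hram h5 _hr f _ ψ ω hψ hω hss hcls
  obtain ⟨m, hm, χ, ε, k, hmp, hχ, hχq, hε, hk, hk2, hkp, hpar, htr, hgoodW⟩ :=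
    KrizLiBinders.exists_krizLiData_of_cmRamified W hCM hram h5
  haveI := hm
  have hclsB : ¬ ‖((p - k : ℕ) : ℚ_[p])⁻¹ * generalizedBernoulli (p - k) χ‖ ≤ (p : ℝ)⁻¹ := fun h ↦
    hcls ((norm_bernoulliOnePrim_inv_le_inv_iff_of_hss W χ ε k ω ψ h5 hχ hχq hmp (fun ℓ _ _ ↦ hε ℓ) hk2 hkp hpar htr
      hgoodW hω hψ hss).mpr h)
  obtain ⟨K, iK, iK', εK, hK, hsplit, hoddK, hd4, hεK, hfld⟩ := hP p m χ k h5 hmp hχ hχq hk hk2 hkp hpar hclsB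
  have hH : SatisfiesHeegnerHypothesis (W.conductorNorm ℤ) K :=
    satisfiesHeegnerHypothesis_of_split_of_classData W hgoodW K hsplit
  refine ⟨K, iK, iK', εK, hK, hH, hoddK, hd4, hεK, fun h ↦ hfld ?_⟩
  exact (norm_bernoulliOnePrim_bernoulliCharTwo_le_inv_iff_of_heegner W χ ε k ω ψ hCM hram h5 hχ hχq hmp (fun ℓ _ _ ↦ hε ℓ)
    hk2 hkp hpar htr hgoodW hω hψ hss K hK hH εK).mp h

end Summit.BirchSwinnertonDyer.BirchSwinnertonDyer.Theorems.PrintCFram.HeegnerFieldSupply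

end
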